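import Summits.AtomisticToContinuum.Crystallization.Theorems.OverbindingBudgetRecurrentDustClosure

/-!
# OverbindingBudget — node «RecurrentDust», limit closure III: loosened unsealedness
(decomp-a2c lens 4, generation 22; helper `--supports stmt-AtomisticToContinuum-31280`; part of the node «RecurrentDust»)

§R `unsealedL_of_limit`: the hull condition `UnsealedL a W P` (two `t`-robustly clean sites closer than `W` are joined by a contact
path of `≤ P` steps through loosened-clean sites, at every loosening `t' ∈ (t, a/50]`) is limit-closed.  No pigeonhole: for ONE small
`ε` transport the clean pair into a good approximant (margins `t ↦ t - 3ε`, robust), link it there at loosening `t' - 3ε`, and carry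
the contact path back INTO the limit node by node (`cleanT_of_match'` at loosened margins `-(t' - 3ε) ↦ -t'`, the sliver condition
holding at every site of a fixed ball of the limit for all small `ε`). [folklore techniques]
-/

noncomputable section

namespace Summit.AtomisticToContinuum.Crystallization.Theorems.OverbindingBudgetRecurrentDustClosureThree

open Filter Metric Set Topology
open Literature.MathematicalPhysics.StatisticalMechanics
open Summit.AtomisticToContinuum.Crystallization.Theorems.OverbindingBudgetWallTensionLever (CleanT TouchT Linked ThinCores BarlowClose)
open Summit.AtomisticToContinuum.Crystallization.Theorems.OverbindingBudgetCleanlessCut (margin_le_of_cleanT)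
open Summit.AtomisticToContinuum.Crystallization.Theorems.OverbindingBudgetRecurrentSealStatements
open Summit.AtomisticToContinuum.Crystallization.Theorems.OverbindingBudgetRecurrentSealClosure
open Summit.AtomisticToContinuum.Crystallization.Theorems.OverbindingBudgetRecurrentDustStatements
open Summit.AtomisticToContinuum.Crystallization.Theorems.OverbindingBudgetRecurrentDustClosure

/-! ## §R  Limit closure of loosened unsealedness -/

/-- Loosened unsealedness passes to local limits (see the module docstring for the transport scheme). [folklore] -/
theorem unsealedL_of_limit {δ a W : ℝ} {P : ℕ} (hδ : 0 < δ) (ha : 47 / 50 ≤ a) (ha1 : a ≤ 1)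
    {Zs : ℕ → Set (EuclideanSpace ℝ (Fin 3))} {Z : Set (EuclideanSpace ℝ (Fin 3))} (hsepk : ∀ k, ∀ p ∈ Zs k, ∀ q ∈ Zs k, p ≠ q → δ ≤ dist p q)
    (hsep : ∀ p ∈ Z, ∀ q ∈ Z, p ≠ q → δ ≤ dist p q)
    (hconv : ∀ R ε : ℝ, 0 < ε → ∀ᶠ k in atTop, Match ε R 0 (Zs k) Z)
    (hU : ∀ k, UnsealedL a W P (Zs k)) : UnsealedL a W P Z := by
  classical
  have ha0 : 0 < a := by linarith
  intro t ht t' htt' ht'a y hy y' hy' hcy hcy' hdW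
  have hta : t ≤ a / 50 := margin_le_of_cleanT hcy
  set R₂ : ℝ := (P : ℝ) * 2 + 4 with hR₂
  have hP0 : (0 : ℝ) ≤ P := Nat.cast_nonneg P
  set R₀ : ℝ := ‖y‖ + |W| + R₂ + 10 with hR₀
  -- the sliver condition at every site of a fixed ball of the limit, for all small `ε`
  have hN : (Z ∩ closedBall y (R₂ + 2)).Finite := UniformlyDiscrete.finite_inter_closedBall (X := Z) ⟨δ, hδ, hsep⟩ y (R₂ + 2)
  have hN' : (Z ∩ closedBall y (R₂ + 6)).Finite := UniformlyDiscrete.finite_inter_closedBall (X := Z) ⟨δ, hδ, hsep⟩ y (R₂ + 6)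
  have hev : ∀ᶠ ε in 𝓝[>] (0 : ℝ), ∀ q ∈ Z ∩ closedBall y (R₂ + 2), ∀ w' ∈ Z ∩ closedBall y (R₂ + 6),
      dist q w' ≤ a * (1 + 1 / 50) ∨ a * (1 + 1 / 50) + 2 * ε < dist q w' := by
    refine hN.eventually_all.2 fun q hq => hN'.eventually_all.2 fun w' hw' => ?_
    by_cases hle : dist q w' ≤ a * (1 + 1 / 50)
    · exact Filter.Eventually.of_forall fun ε => Or.inl hle
    · push Not at hle
      have hlt : (0 : ℝ) < (dist q w' - a * (1 + 1 / 50)) / 2 := by linarith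
      exact ((eventually_lt_nhds hlt).filter_mono nhdsWithin_le_nhds).mono fun ε h => Or.inr (by linarith)
  set ε₁ : ℝ := min (t / 4) (min (δ / 4) (min (1 / 200) (min ((t' - t) / 4) ((W - dist y y') / 3)))) with hε₁
  have hε₁0 : 0 < ε₁ := by
    have h1 : 0 < (t' - t) / 4 := by linarith
    have h2 : 0 < (W - dist y y') / 3 := by linarith
    positivity
  have h2 : ∀ᶠ ε in 𝓝[>] (0 : ℝ), ε < ε₁ := (eventually_lt_nhds hε₁0).filter_mono nhdsWithin_le_nhds
  have h3 : ∀ᶠ ε in 𝓝[>] (0 : ℝ), 0 < ε := eventually_mem_nhdsWithin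
  obtain ⟨ε, hsl, hεlt, hε0⟩ := (hev.and (h2.and h3)).exists
  have hεt : 4 * ε < t := by
    have := min_le_left (t / 4) (min (δ / 4) (min (1 / 200) (min ((t' - t) / 4) ((W - dist y y') / 3)))); linarith
  have hεδ : 2 * ε < δ := by
    have := (min_le_right (t / 4) (min (δ / 4) (min (1 / 200) (min ((t' - t) / 4) ((W - dist y y') / 3))))).trans
      (min_le_left _ _); linarith
  have hε200 : ε ≤ 1 / 200 := by
    have := ((min_le_right (t / 4) (min (δ / 4) (min (1 / 200) (min ((t' - t) / 4) ((W - dist y y') / 3))))).trans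
      (min_le_right _ _)).trans (min_le_left _ _); linarith
  have hεW : 3 * ε < W - dist y y' := by
    have := (((min_le_right (t / 4) (min (δ / 4) (min (1 / 200) (min ((t' - t) / 4) ((W - dist y y') / 3))))).trans
      (min_le_right _ _)).trans (min_le_right _ _)).trans (min_le_right _ _); linarith
  have hεa : 100 * ε ≤ a := by linarith
  -- one good approximant
  obtain ⟨k, hk⟩ := (hconv R₀ ε hε0).exists
  choose! ψ hψB hψd using hk.1
  choose! φ hφZ hφd using hk.2
  have hy'n : ‖y'‖ ≤ ‖y‖ + |W| := by
    have := norm_le_of_dist_le (show dist y' y ≤ |W| by rw [dist_comm]; exact hdW.le.trans (le_abs_self W))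
    linarith
  have hy0 : dist y 0 ≤ R₀ := by rw [dist_zero_right]; linarith [abs_nonneg W, norm_nonneg y]
  have hy'0 : dist y' 0 ≤ R₀ := by rw [dist_zero_right]; linarith [abs_nonneg W]
  have hψy : ψ y ∈ Zs k ∧ dist y (ψ y) ≤ ε := ⟨hψB y hy hy0, by rw [dist_comm]; exact hψd y hy hy0⟩
  have hψy' : ψ y' ∈ Zs k ∧ dist y' (ψ y') ≤ ε := ⟨hψB y' hy' hy'0, by rw [dist_comm]; exact hψd y' hy' hy'0⟩
  -- the clean pair, transported (robust margins)
  have hc₁ : CleanT a (t - 3 * ε) (Zs k) (ψ y) :=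
    cleanT_of_match' hsep (hsepk k) hε0.le hεδ hk.symm ha0 hεa (by linarith) hta (by linarith) (by nlinarith)
      hy hψy.1 hψy.2 (by linarith [abs_nonneg W]) (Or.inl (by linarith)) hcy
  have hc₂ : CleanT a (t - 3 * ε) (Zs k) (ψ y') :=
    cleanT_of_match' hsep (hsepk k) hε0.le hεδ hk.symm ha0 hεa (by linarith) (margin_le_of_cleanT hcy') (by linarith)
      (by nlinarith) hy' hψy'.1 hψy'.2 (by linarith) (Or.inl (by linarith)) hcy'
  have hdW' : dist (ψ y) (ψ y') < W := by
    have h1 := dist_triangle (ψ y) y (ψ y')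
    have h2 := dist_triangle y y' (ψ y')
    have h3 := dist_comm (ψ y) y
    linarith [hψy.2, hψy'.2]
  -- link in the approximant at loosening `t' - 3ε`
  obtain ⟨n, hnP, z, hz0, hzn, hzcl, hzt⟩ :=
    hU k (t - 3 * ε) (by linarith) (t' - 3 * ε) (by linarith) (by linarith) (ψ y) hψy.1 (ψ y') hψy'.1 hc₁ hc₂ hdW'
  -- the nodes stay in a fixed ball
  have hnode : ∀ i : ℕ, i ≤ n → dist (z i) (z 0) ≤ (i : ℝ) * 2 := by
    intro i
    induction i with
    | zero => intro _; simp
    | succ j ih =>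
      intro hj
      have hj' : j < n := Nat.lt_of_succ_le hj
      have h1 := ih hj'.le
      have h4 := (hzt j hj').2
      have h5 := dist_triangle (z (j + 1)) (z j) (z 0)
      have h6 := dist_comm (z (j + 1)) (z j)
      push_cast
      nlinarith
  have hnP' : (n : ℝ) ≤ P := by exact_mod_cast hnP
  have hzR : ∀ i : ℕ, i ≤ n → dist (z i) 0 ≤ R₀ ∧ ‖z i‖ + 2 * a ≤ R₀ ∧ dist (z i) y ≤ R₂ + 1 := by
    intro i hi
    have h1 := hnode i hi
    rw [hz0] at h1
    have hi' : (i : ℝ) ≤ n := by exact_mod_cast hi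
    have h4 : dist (z i) y ≤ R₂ + 1 := by
      have h5 := dist_triangle (z i) (ψ y) y
      have h6 := dist_comm (ψ y) y
      nlinarith [hψy.2]
    have h7 := norm_le_of_dist_le h4
    refine ⟨by rw [dist_zero_right]; linarith [abs_nonneg W], by linarith [abs_nonneg W], h4⟩
  have hφz : ∀ i : ℕ, i ≤ n → φ (z i) ∈ Z ∧ dist (z i) (φ (z i)) ≤ ε ∧ φ (z i) ∈ Z ∩ closedBall y (R₂ + 2) := by
    intro i hi
    have hmem := (hzcl i hi).1
    refine ⟨hφZ _ hmem (hzR i hi).1, hφd _ hmem (hzR i hi).1, hφZ _ hmem (hzR i hi).1, mem_closedBall.2 ?_⟩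
    have h1 := dist_triangle (φ (z i)) (z i) y
    have h2 := dist_comm (φ (z i)) (z i)
    linarith [hφd _ hmem (hzR i hi).1, (hzR i hi).2.2]
  -- partners of partners are the original limit sites
  have hback : ∀ x ∈ Z, dist x 0 ≤ R₀ → dist (ψ x) 0 ≤ R₀ → φ (ψ x) = x := by
    intro x hx hx0 hψx0
    by_contra hne
    have h1 := hsep _ (hφZ _ (hψB x hx hx0) hψx0) x hx hne
    have h4 := dist_triangle (φ (ψ x)) (ψ x) x
    have h5 := dist_comm (φ (ψ x)) (ψ x)
    linarith [hφd _ (hψB x hx hx0) hψx0, hψd x hx hx0]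
  have h0n : 0 ≤ n := Nat.zero_le n
  refine ⟨n, hnP, fun i => φ (z i), ?_, ?_, fun i hi => ⟨(hφz i hi).1, ?_⟩, fun i hi => ?_⟩
  · show φ (z 0) = y
    rw [hz0]; exact hback y hy hy0 (by rw [← hz0]; exact (hzR 0 h0n).1)
  · show φ (z n) = y'
    rw [hzn]; exact hback y' hy' hy'0 (by rw [← hzn]; exact (hzR n le_rfl).1)
  · -- loosened cleanness of the carried node, margin `-(t' - 3ε) ↦ -t'`, sliver condition at the limit site
    have hthr : (0 : ℝ) ≤ -t' ∨ ∀ w' ∈ Z, w' ≠ φ (z i) →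
        dist (φ (z i)) w' ≤ a * (1 + 1 / 50) ∨ a * (1 + 1 / 50) + 2 * ε < dist (φ (z i)) w' := by
      refine Or.inr fun w' hw' _ => ?_
      by_cases hw3 : dist (φ (z i)) w' ≤ 3
      · refine hsl _ (hφz i hi).2.2 w' ⟨hw', mem_closedBall.2 ?_⟩
        have h1 := dist_triangle w' (φ (z i)) y
        have h2 := dist_comm w' (φ (z i))
        linarith [mem_closedBall.1 (hφz i hi).2.2.2]
      · push Not at hw3
        exact Or.inr (by linarith)
    exact cleanT_of_match' (hsepk k) hsep hε0.le hεδ hk ha0 hεa (by linarith) (by linarith) (by linarith) (by nlinarith)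
      (hzcl i hi).1 (hφz i hi).1 (hφz i hi).2.1 (hzR i hi).2.1 hthr (hzcl i hi).2
  · -- contacts survive the carry
    obtain ⟨hne, hd⟩ := hzt i hi
    have hi1 : i + 1 ≤ n := hi
    refine ⟨fun heq => ?_, ?_⟩
    · have heq' : φ (z i) = φ (z (i + 1)) := heq
      have h1 := hsepk k _ (hzcl i hi.le).1 _ (hzcl (i + 1) hi1).1 hne
      have h4 := dist_triangle (z i) (φ (z i)) (z (i + 1))
      have h5 : dist (φ (z i)) (z (i + 1)) ≤ ε := by rw [heq', dist_comm]; exact (hφz (i + 1) hi1).2.1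
      linarith [(hφz i hi.le).2.1]
    · show dist (φ (z i)) (φ (z (i + 1))) ≤ a * (1 + 1 / 50) - -t'
      have h4 := dist_triangle (φ (z i)) (z i) (φ (z (i + 1)))
      have h5 := dist_triangle (z i) (z (i + 1)) (φ (z (i + 1)))
      have h6 := dist_comm (φ (z i)) (z i)
      linarith [(hφz i hi.le).2.1, (hφz (i + 1) hi1).2.1]

end Summit.AtomisticToContinuum.Crystallization.Theorems.OverbindingBudgetRecurrentDustClosureThree

end
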